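import Literature.FieldTheory.FunctionField.RationalCompositionFactors
import Mathlib.FieldTheory.RatFunc.Luroth
import Mathlib.FieldTheory.PrimitiveElement
import Mathlib.Order.Preorder.Finite
import Mathlib.Data.Fin.SuccPred
import HarnessLib

/-!
# The Lüroth lattice of `K(u)/K(w)`: right composition factors ↔ the interval `[K(w), K(u)]`, finitely many
# decomposition classes, indecomposable `⟺` coatom, complete decompositions = saturated chains
# (Ritt 1922 §I–II; Zieve–Müller §2.1; Gutierrez–Sevilla Def. 1, §4)

Topic `Literature/FieldTheory/FunctionField`; namespace `Literature.FieldTheory.FunctionField`.  Lane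
`lit-hodgefound` (Track 2 foundations library), seat p01 gen 26, row g26-#1.  THEOREMS ONLY (no definition, no
named fact, no instance, no notation; D-0014/D-0026, net Literature debt 0).  Sequel BY IMPORT of g25-#9
`RationalCompositionFactors` (§1 there: `K(w) ⊆ K(v) ⟺ w = f ∘ v`, `K(w) = K(v) ⟺ w = f ∘ v` with `deg f = 1`), g25-#1
`RationalSubstitutionDegree` (`σ_v(K(f)) = K(f ∘ v)`, `σ_v(K(t)) = K(v)`, `[K(v) : K(f ∘ v)] = deg f`,
`deg(f ∘ v) = deg f · deg v`), g22-#3 (`σ_v = ratFuncSubst v hv`), and of Mathlib's LÜROTH THEOREM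
(`RatFunc.Luroth.eq_adjoin_generator`: every intermediate field of `K(u)/K` is `K(v)` for its Lüroth `generator`),
STEINITZ' THEOREM (`Field.finite_intermediateField_of_exists_primitive_element`: a finite simple extension has finitely
many intermediate fields), `RatFunc.IntermediateField.adjoin_X` (`E(u) = K(u)`), `RatFunc.finrank_eq_max_natDegree`
(`[K(u) : K(w)] = deg w`) and `IntermediateField.relfinrank` — REUSED, nothing restated.

## Sources, VERBATIM

J. F. Ritt, *Prime and composite polynomials*, Trans. AMS 23 (1922) 51–66 [Ritt1922] (held
`paper:doi-10-1090-s0002-9947-1922-1501189-9`), §I p. 51: «If there exist two polynomials, `φ₁(z)` and `φ₂(z)`, each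
of degree greater than unity, such that (1) `F(z) = φ₁[φ₂(z)]`, we shall say that `F(z)` is composite.  If no such pair
of polynomials exists we shall say that `F(z)` is prime.»; p. 52: «If the degrees of `φ(z)` and `α(z)` are prime […]
the four polynomials will be prime»; p. 53: «The analogous problem for fractional rational functions is much more
difficult. […] There are even cases in which the number of prime functions in one decomposition is different from that
in another.»; §II p. 53 (for «a general rational function, integral or fractional»): «A necessary and sufficient
condition that `F(z)` be composite is that the group of `F⁻¹(w)` be imprimitive.»

M. E. Zieve, P. Müller, *On Ritt's polynomial decomposition theorems*, arXiv:0807.3578 [ZieveMueller2008] (held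
`paper:arxiv-0807.3578`, p0006), §2.1, Lemma (Lüroth): «The map `ρ : (a, b) ↦ C(b(x))` is a surjection from `S` onto
the set of fields between `C(x)` and `C(t)`. […] `ρ((a,b)) = C(d(x))` if and only if there is a linear `ℓ` […] such
that `d = ℓ ∘ b` […] Moreover, `[C(x) : C(b(x))] = deg(b)` and `[C(b(x)) : C(t)] = deg(a)`.  Proof. Let `E` be a field
between `C(x)` and `C(t)`. By Lüroth's theorem, `E = C(b(x))` for some `b ∈ C(X)`. […] Since `t = f(x)` lies in
`C(b(x))`, we have `f(X) = a(b(X))` for some `a ∈ C(X)`.»; «Such a decomposition corresponds to the chain of fields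
`C(x) ⊃ C(a_r(x)) ⊃ C(a_{r−1} ∘ a_r(x)) ⊃ ⋯ ⊃ C(a₁ ∘ ⋯ ∘ a_r(x))`»; Corollary: «The map `θ` induces a bijection between
equivalence classes of decompositions of `f` and decreasing chains of fields from `C(x)` to `C(t)`. If the
decomposition `(a₁, …, a_r)` corresponds to the chain of fields `C(x) = E_r > E_{r−1} > ⋯ > E₀ = C(t)`, then
`[E_i : E_{i−1}] = deg(a_i)`»; Corollary: «There are only finitely many equivalence classes of decompositions of `f`.»
(there for polynomials over `ℂ`, via the finitely many groups between `H` and `G`; HERE for every rational function over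
EVERY field `K`, via Steinitz' theorem — `u` is a primitive element of `K(u)/K(w)`, separable or not).

J. Gutierrez, D. Sevilla, *Building counterexamples to generalizations for rational functions of Ritt's decomposition
theorem*, J. Algebra 303 (2006) 655–667 = arXiv:0804.1687 [GutierrezSevilla2008] (held `paper:arxiv-0804.1687`),
Def. 1 p0003: «If `f = g ∘ h`, `f, g, h ∈ K(x)`, we call this a decomposition of `f` in `K(x)` […] We call a
decomposition trivial if any of the components is a unit with respect to decomposition. […] Given a non-constant `f`,
we say that it is indecomposable if it is not a unit and all its decompositions are trivial.  We define a complete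
decomposition of `f` to be `f = g₁ ∘ ⋯ ∘ g_r` where `g_i` is indecomposable. […] we define the degree of `f` as
`deg f = max{deg f_N, deg f_D}`»; §3 p0005: «Möbius transformations […] are also the units of `K(x)` under
composition», Remark 2: «`K(f) = K(f′)` if and only if `f = u ∘ f′` for some unit `u`»; §4 p0008: «All the components
except one have prime degree, hence are indecomposable», «Unlike for polynomials, it is not true that all complete
decompositions of a rational function have the same length».

## Dictionary (all `w, v, f, g ∈ K(u) = RatFunc K`; `deg f := max(deg num f, deg denom f)`; `σ_v f = f ∘ v =
## ratFuncSubst v hv f` for `v` non-constant; `K(w) = IntermediateField.adjoin K {w}`)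

* units (Möbius) `⟺ deg = 1 ⟺ K(w) = K(u) = ⊤` (§1); constants `⟺ deg = 0 ⟺ K(w) = K = ⊥` (§1);
* right components `v` of `w` (`w = f ∘ v`) `⟷` fields `K(v) ⊇ K(w)`, equivalent ones `⟷` the same field (g25-#9 §1
  and, by Lüroth, ONTO the interval: §2);
* `v` indecomposable (`deg v ≥ 2`, every decomposition trivial) `⟺ K(v)` is a COATOM of the lattice
  `IntermediateField K (RatFunc K)` (§4 — the field form of Ritt's §II criterion: `K(u) ⊋ E ⊋ K(v)` is an
  imprimitivity system); one indecomposable LEFT step `f` in `w = f ∘ v` `⟺ K(f ∘ v) ⋖ K(v)` (§5);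
* complete decompositions `w = g₁ ∘ ⋯ ∘ g_n` `⟷` saturated chains `K(w) = E₀ ⋖ E₁ ⋖ ⋯ ⋖ E_n = K(u)` with
  `[E_i : E_{i−1}] = deg g_i ≥ 2` (§6).

## What is proved (`K` ANY field)

* §1 `adjoin_eq_top_iff_max_natDegree_eq_one` (`K(w) = K(u) ⟺ deg w = 1`), `adjoin_eq_bot_iff_exists_eq_C`
  (`K(w) = K ⟺ w` constant), `max_natDegree_ne_zero_of_ne_C`, `adjoin_ne_bot_of_ne_C`,
  `adjoin_ratFuncSubst_lt_adjoin_iff` (`K(f ∘ v) < K(v) ⟺ deg f ≠ 1`).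
* §2 (Lüroth on the interval) `exists_eq_ratFuncSubst_generator` (`K(w) ≤ L ≠ K ⟹ w = f ∘ gen(L)`),
  **`adjoin_le_iff_exists_rightFactor`** (`K(w) ≤ L ⟺ L = K(v)` for a right component `v` of `w` — the surjection `ρ`),
  `lt_adjoin_iff_exists_leftFactor` (dually `K < L ≤ K(w) ⟺ L = K(f ∘ w)`, `f` non-constant).
* §3 (finiteness, Steinitz) **`finite_intermediateField_adjoin`** (`K(u)/K(w)` has finitely many intermediate fields),
  **`finite_setOf_adjoin_le`** (the interval `[K(w), K(u)]` is finite), `finite_setOf_adjoin_rightFactor` (finitely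
  many classes of right components).
* §4 (indecomposables) **`isCoatom_adjoin_iff`** (`K(v)` coatom `⟺ deg v ≥ 2 ∧` every decomposition `v = f ∘ g` has
  `deg f = 1 ∨ deg g = 1`), **`isCoatom_adjoin_of_prime`** (prime degree ⟹ indecomposable), `max_natDegree_X_sq`,
  `X_sq_ne_C`, `adjoin_sq_lt_adjoin` (`K(v²) ⊊ K(v)`), `not_isAtom` (the lattice has NO atoms), `not_bot_covBy`.
* §5 (transport along `σ_v`) `map_le_map_iff_of_algHom`, `map_lt_map_iff_of_algHom`, `map_comap_eq_of_le_map_top`,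
  `map_covBy_map_iff_of_algHom` (`map σ` is an order isomorphism of the whole lattice onto the lower interval
  `[K, σ(K(u))]`, preserving and reflecting `⋖`), `map_top_ratFuncSubst` (`σ_v(K(u)) = K(v)`),
  `adjoin_ratFuncSubst_le_adjoin_ratFuncSubst_iff`, `adjoin_ratFuncSubst_covBy_adjoin_ratFuncSubst_iff`
  (`K(f) ⋖ K(g) ⟺ K(f ∘ v) ⋖ K(g ∘ v)`), **`covBy_adjoin_ratFuncSubst_iff`** (`K(f ∘ v) ⋖ K(v) ⟺ K(f)` coatom `⟺ f`
  indecomposable).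
* §6 (complete decompositions) **`exists_rightFactor_isCoatom`** (every `w` of degree `≥ 2` has an indecomposable
  right component), **`exists_leftFactor_covBy`** (and an indecomposable left component: `K(w) ⋖ K(v)`, `w = f ∘ v`,
  `K(f)` coatom), **`exists_saturatedChain`** (a saturated chain `K(w) = E₀ ⋖ ⋯ ⋖ E_n = K(u)` exists),
  **`two_pow_le_max_natDegree_of_chain`** (every strict chain from `K(w)` to `K(u)` with `n` steps has `2ⁿ ≤ deg w`:
  degrees multiply along the chain and each step has relative degree `≥ 2`).

## Honest scope

Ritt's FIRST theorem (equal length of all complete decompositions) is NOT asserted: it is a theorem for (tame)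
POLYNOMIALS and is FALSE for rational functions (Ritt p. 53; Gutierrez–Sevilla §4 exhibit a degree-12 function over
`ℚ` with complete decompositions of lengths 3 and 2) — here only the lattice dictionary, finiteness and existence.
Ritt's §II is rendered on the FIELD side (coatoms); the monodromy/Galois-group side (imprimitivity) is not formalised.
-/

noncomputable section

open Polynomial IntermediateField

namespace Literature.FieldTheory.FunctionField

variable {K : Type*} [Field K]

/-! ### §1. The extremes of the lattice: units and constants -/

/-- **`K(w) = K(u)` iff `deg w = 1`** (units of composition = Möbius maps; `[K(u) : K(w)] = deg w`).
[cite: GutierrezSevilla2008, §3 (units = Möbius transformations)][cite: ZieveMueller2008, §2.1 Lemma (Lüroth)] -/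
theorem adjoin_eq_top_iff_max_natDegree_eq_one (w : RatFunc K) :
    IntermediateField.adjoin K ({w} : Set (RatFunc K)) = ⊤ ↔ max w.num.natDegree w.denom.natDegree = 1 := by
  rw [← RatFunc.finrank_eq_max_natDegree, IntermediateField.finrank_eq_one_iff_eq_top]

/-- **`K(w) = K` iff `w` is constant.** [cite: GutierrezSevilla2008, Def. 1 (deg a = 0 for a ∈ K)] -/
theorem adjoin_eq_bot_iff_exists_eq_C (w : RatFunc K) :
    IntermediateField.adjoin K ({w} : Set (RatFunc K)) = ⊥ ↔ ∃ c, w = RatFunc.C c := by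
  rw [IntermediateField.adjoin_simple_eq_bot_iff, IntermediateField.mem_bot, Set.mem_range, RatFunc.algebraMap_eq_C]
  exact ⟨fun ⟨c, hc⟩ => ⟨c, hc.symm⟩, fun ⟨c, hc⟩ => ⟨c, hc.symm⟩⟩

/-- `deg w ≠ 0` for `w` non-constant. [cite: GutierrezSevilla2008, Def. 1] -/
theorem max_natDegree_ne_zero_of_ne_C {w : RatFunc K} (hw : ¬ ∃ c, w = RatFunc.C c) :
    max w.num.natDegree w.denom.natDegree ≠ 0 := fun h =>
  hw ((RatFunc.eq_C_iff w).mpr (Nat.max_eq_zero_iff.mp h))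

/-- `K(w) ≠ K` for `w` non-constant. [cite: GutierrezSevilla2008, Def. 1] -/
theorem adjoin_ne_bot_of_ne_C {w : RatFunc K} (hw : ¬ ∃ c, w = RatFunc.C c) :
    IntermediateField.adjoin K ({w} : Set (RatFunc K)) ≠ ⊥ := fun h =>
  hw ((adjoin_eq_bot_iff_exists_eq_C w).mp h)

section Subst

variable (v : RatFunc K) (hv : ¬ ∃ c, v = RatFunc.C c)

/-- **`K(f ∘ v) ⊊ K(v)` iff `deg f ≠ 1`** (`[K(v) : K(f ∘ v)] = deg f`; equivalent decompositions differ by a unit).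
[cite: ZieveMueller2008, §2.1 Lemma (Lüroth)][cite: GutierrezSevilla2008, §3 Remark 2] -/
theorem adjoin_ratFuncSubst_lt_adjoin_iff (f : RatFunc K) :
    IntermediateField.adjoin K ({ratFuncSubst v hv f} : Set (RatFunc K)) <
        IntermediateField.adjoin K ({v} : Set (RatFunc K)) ↔ max f.num.natDegree f.denom.natDegree ≠ 1 := by
  rw [lt_iff_le_and_ne, and_iff_right (adjoin_ratFuncSubst_le v hv f), Ne,
    adjoin_eq_adjoin_iff_exists_ratFuncSubst v hv]
  constructor
  · exact fun h hf => h ⟨f, rfl, hf⟩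
  · rintro h ⟨g, hg, hg1⟩
    rw [ratFuncSubst_injective v hv hg] at h
    exact h hg1

end Subst

/-! ### §2. Lüroth on the interval `[K(w), K(u)]`: every field above `K(w)` is `K(v)` for a right component `v` -/

/-- **`K(w) ≤ L ≠ K ⟹ w = f ∘ gen(L)`**: «Since `t = f(x)` lies in `C(b(x))`, we have `f(X) = a(b(X))`», with `b` the
Lüroth generator of `L`. [cite: ZieveMueller2008, §2.1 Lemma (Lüroth), proof] -/
theorem exists_eq_ratFuncSubst_generator {L : IntermediateField K (RatFunc K)} (hL : L ≠ ⊥) {w : RatFunc K}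
    (hw : IntermediateField.adjoin K ({w} : Set (RatFunc K)) ≤ L) :
    ∃ f : RatFunc K, w = ratFuncSubst (RatFunc.Luroth.generator L) (RatFunc.Luroth.generator_ne_C hL) f := by
  rw [← mem_adjoin_iff_exists_ratFuncSubst]
  have h : w ∈ L := adjoin_simple_le_iff.mp hw
  rw [RatFunc.Luroth.eq_adjoin_generator (E := L)] at h
  exact h

/-- **The surjection `ρ` (Lüroth on the interval): `K(w) ≤ L` iff `L = K(v)` for some right component `v` of `w`,
`w = f ∘ v`** («`ρ : (a, b) ↦ C(b(x))` is a surjection from `S` onto the set of fields between `C(x)` and `C(t)`»;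
here any field `K`, any non-constant `w ∈ K(u)`). [cite: ZieveMueller2008, §2.1 Lemma (Lüroth)][cite: GutierrezSevilla2008, Def. 1] -/
theorem adjoin_le_iff_exists_rightFactor {w : RatFunc K} (hw : ¬ ∃ c, w = RatFunc.C c)
    (L : IntermediateField K (RatFunc K)) :
    IntermediateField.adjoin K ({w} : Set (RatFunc K)) ≤ L ↔
      ∃ (v : RatFunc K) (hv : ¬ ∃ c, v = RatFunc.C c) (f : RatFunc K),
        w = ratFuncSubst v hv f ∧ L = IntermediateField.adjoin K ({v} : Set (RatFunc K)) := by
  constructor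
  · intro h
    have hL : L ≠ ⊥ := fun hb => adjoin_ne_bot_of_ne_C hw (le_bot_iff.mp (hb ▸ h))
    obtain ⟨f, hf⟩ := exists_eq_ratFuncSubst_generator hL h
    exact ⟨_, RatFunc.Luroth.generator_ne_C hL, f, hf, RatFunc.Luroth.eq_adjoin_generator⟩
  · rintro ⟨v, hv, f, rfl, rfl⟩
    exact adjoin_ratFuncSubst_le v hv f

/-- Dually, **the fields `K ⊊ L ≤ K(w)` are the `K(f ∘ w)` with `f` non-constant** (left components of the elements
of `K(w)`; `σ_w : K(t) ≅ K(w)`). [cite: ZieveMueller2008, §2.1 Lemma (Lüroth)] -/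
theorem lt_adjoin_iff_exists_leftFactor {w : RatFunc K} (hw : ¬ ∃ c, w = RatFunc.C c)
    (L : IntermediateField K (RatFunc K)) :
    (⊥ < L ∧ L ≤ IntermediateField.adjoin K ({w} : Set (RatFunc K))) ↔
      ∃ f : RatFunc K, (¬ ∃ c, f = RatFunc.C c) ∧
        L = IntermediateField.adjoin K ({ratFuncSubst w hw f} : Set (RatFunc K)) := by
  constructor
  · rintro ⟨hbot, hle⟩
    have hL : L ≠ ⊥ := hbot.ne'
    have hgen : RatFunc.Luroth.generator L ∈ IntermediateField.adjoin K ({w} : Set (RatFunc K)) :=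
      hle RatFunc.Luroth.generator_mem
    obtain ⟨f, hf⟩ := (mem_adjoin_iff_exists_ratFuncSubst w hw _).mp hgen
    refine ⟨f, fun hfc => RatFunc.Luroth.generator_ne_C hL ?_, ?_⟩
    · rw [hf]
      exact (ratFuncSubst_eq_C_iff w hw f).mpr hfc
    · rw [← hf]
      exact RatFunc.Luroth.eq_adjoin_generator
  · rintro ⟨f, hf, rfl⟩
    exact ⟨bot_lt_iff_ne_bot.mpr (adjoin_ne_bot_of_ne_C (ratFuncSubst_ne_C w hw hf)), adjoin_ratFuncSubst_le w hw f⟩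

/-! ### §3. Finiteness (Steinitz): finitely many fields between `K(w)` and `K(u)`, hence finitely many
decomposition classes -/

/-- **`K(u)/K(w)` has only finitely many intermediate fields** for `w` non-constant: `u` is a primitive element of the
finite extension `K(u)/K(w)` (Steinitz; no separability needed).  («There are only finitely many equivalence classes
of decompositions» — there via group theory for polynomials over `ℂ`.) [cite: ZieveMueller2008, §2.1 Corollary (finiteness)] -/
theorem finite_intermediateField_adjoin {w : RatFunc K} (hw : ¬ ∃ c, w = RatFunc.C c) :
    Finite (IntermediateField (IntermediateField.adjoin K ({w} : Set (RatFunc K))) (RatFunc K)) := by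
  haveI := RatFunc.isAlgebraic_adjoin_simple_X' w hw
  exact Field.finite_intermediateField_of_exists_primitive_element _ _
    ⟨RatFunc.X, RatFunc.IntermediateField.adjoin_X _⟩

/-- **The interval `[K(w), K(u)]` of the lattice of intermediate fields of `K(u)/K` is finite.**
[cite: ZieveMueller2008, §2.1 Corollary (finiteness)] -/
theorem finite_setOf_adjoin_le {w : RatFunc K} (hw : ¬ ∃ c, w = RatFunc.C c) :
    {L : IntermediateField K (RatFunc K) | IntermediateField.adjoin K ({w} : Set (RatFunc K)) ≤ L}.Finite := by
  haveI := finite_intermediateField_adjoin hw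
  have : Finite {L : IntermediateField K (RatFunc K) // IntermediateField.adjoin K ({w} : Set (RatFunc K)) ≤ L} :=
    Finite.of_equiv _
      (IntermediateField.extendScalars.orderIso (IntermediateField.adjoin K ({w} : Set (RatFunc K)))).toEquiv.symm
  exact Set.finite_coe_iff.mp this

/-- **Finitely many classes of right components**: the fields `K(v)`, `v` a right component of `w`, form a finite set
(equivalent components `v ~ ℓ ∘ v`, `deg ℓ = 1`, giving the same field). [cite: ZieveMueller2008, §2.1 Corollary (finiteness)][cite: GutierrezSevilla2008, Def. 1] -/
theorem finite_setOf_adjoin_rightFactor {w : RatFunc K} (hw : ¬ ∃ c, w = RatFunc.C c) :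
    {L : IntermediateField K (RatFunc K) | ∃ (v : RatFunc K) (hv : ¬ ∃ c, v = RatFunc.C c) (f : RatFunc K),
        w = ratFuncSubst v hv f ∧ L = IntermediateField.adjoin K ({v} : Set (RatFunc K))}.Finite :=
  (finite_setOf_adjoin_le hw).subset fun L hL => (adjoin_le_iff_exists_rightFactor hw L).mpr hL

/-! ### §4. Indecomposable `⟺` coatom; prime degree; no atoms -/

section Coatom

variable (v : RatFunc K)

/-- `deg(u²) = 2`. [cite: GutierrezSevilla2008, Def. 1 (deg)] -/
theorem max_natDegree_X_sq :
    max ((RatFunc.X : RatFunc K) ^ 2).num.natDegree ((RatFunc.X : RatFunc K) ^ 2).denom.natDegree = 2 := by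
  rw [show (RatFunc.X : RatFunc K) ^ 2 = algebraMap K[X] (RatFunc K) (Polynomial.X ^ 2) by
      rw [map_pow, RatFunc.algebraMap_X],
    RatFunc.num_algebraMap, RatFunc.denom_algebraMap, natDegree_X_pow, natDegree_one, Nat.max_eq_left (Nat.zero_le _)]

/-- `u²` is not constant. [cite: GutierrezSevilla2008, Def. 1 (deg)] -/
theorem X_sq_ne_C : ¬ ∃ c, (RatFunc.X : RatFunc K) ^ 2 = RatFunc.C c := fun h => by
  have h0 := (RatFunc.eq_C_iff _).mp h
  have h2 := max_natDegree_X_sq (K := K)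
  rw [h0.1, h0.2, max_self] at h2
  exact two_ne_zero h2.symm

/-- **`v` is indecomposable iff `K(v)` is a coatom of the lattice of intermediate fields of `K(u)/K`**: `K(v)` is a
maximal proper subfield iff `deg v ≥ 2` and in every decomposition `v = f ∘ g` one component is a unit
(`deg f = 1 ∨ deg g = 1`) — the field form of «`F` composite ⟺ the group of `F⁻¹(w)` imprimitive».
[cite: Ritt1922, §I p. 51, §II p. 53][cite: GutierrezSevilla2008, Def. 1][cite: ZieveMueller2008, §2.1 Lemma (Lüroth)] -/
theorem isCoatom_adjoin_iff (hv : ¬ ∃ c, v = RatFunc.C c) :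
    IsCoatom (IntermediateField.adjoin K ({v} : Set (RatFunc K))) ↔
      2 ≤ max v.num.natDegree v.denom.natDegree ∧
        ∀ (g : RatFunc K) (hg : ¬ ∃ c, g = RatFunc.C c) (f : RatFunc K), v = ratFuncSubst g hg f →
          max f.num.natDegree f.denom.natDegree = 1 ∨ max g.num.natDegree g.denom.natDegree = 1 := by
  have h0 := max_natDegree_ne_zero_of_ne_C hv
  constructor
  · rintro ⟨htop, hmax⟩
    refine ⟨?_, fun g hg f hfg => ?_⟩
    · have h1 : max v.num.natDegree v.denom.natDegree ≠ 1 := fun h =>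
        htop ((adjoin_eq_top_iff_max_natDegree_eq_one v).mpr h)
      omega
    · by_cases heq : IntermediateField.adjoin K ({v} : Set (RatFunc K)) =
          IntermediateField.adjoin K ({g} : Set (RatFunc K))
      · obtain ⟨f', hf', hf'1⟩ := (adjoin_eq_adjoin_iff_exists_ratFuncSubst g hg v).mp heq
        rw [hfg] at hf'
        rw [ratFuncSubst_injective g hg hf']
        exact Or.inl hf'1
      · have hlt : IntermediateField.adjoin K ({v} : Set (RatFunc K)) <
            IntermediateField.adjoin K ({g} : Set (RatFunc K)) :=
          lt_of_le_of_ne (hfg ▸ adjoin_ratFuncSubst_le g hg f) heq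
        exact Or.inr ((adjoin_eq_top_iff_max_natDegree_eq_one g).mp (hmax _ hlt))
  · rintro ⟨h2, hind⟩
    refine ⟨fun htop => ?_, fun M hM => ?_⟩
    · have h1 := (adjoin_eq_top_iff_max_natDegree_eq_one v).mp htop
      omega
    · have hM' : M ≠ ⊥ := ne_bot_of_gt hM
      obtain ⟨f, hf⟩ := exists_eq_ratFuncSubst_generator hM' hM.le
      rcases hind _ (RatFunc.Luroth.generator_ne_C hM') f hf with h1 | h1
      · exact absurd (((adjoin_eq_adjoin_iff_exists_ratFuncSubst _ _ v).mpr ⟨f, hf, h1⟩).trans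
          (RatFunc.Luroth.eq_adjoin_generator (E := M)).symm) hM.ne
      · rw [RatFunc.Luroth.eq_adjoin_generator (E := M)]
        exact (adjoin_eq_top_iff_max_natDegree_eq_one _).mpr h1

/-- **Prime degree ⟹ indecomposable** («All the components except one have prime degree, hence are indecomposable»;
Ritt: «If the degrees […] are prime […] the polynomials will be prime»): `deg(f ∘ g) = deg f · deg g`.
[cite: GutierrezSevilla2008, §4][cite: Ritt1922, §I p. 52] -/
theorem isCoatom_adjoin_of_prime (hp : (max v.num.natDegree v.denom.natDegree).Prime) :
    IsCoatom (IntermediateField.adjoin K ({v} : Set (RatFunc K))) := by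
  have hv : ¬ ∃ c, v = RatFunc.C c := by
    rintro ⟨c, rfl⟩
    rw [RatFunc.num_C, RatFunc.denom_C, natDegree_C, natDegree_one, max_self] at hp
    exact Nat.not_prime_zero hp
  refine (isCoatom_adjoin_iff v hv).mpr ⟨hp.two_le, fun g hg f hfg => ?_⟩
  have hmul := max_natDegree_ratFuncSubst g hg f
  rw [← hfg] at hmul
  rw [hmul, Nat.prime_mul_iff] at hp
  rcases hp with ⟨-, h⟩ | ⟨-, h⟩
  · exact Or.inr h
  · exact Or.inl h

/-- `K(v²) ⊊ K(v)`: `deg(t²) = 2 ≠ 1`. [cite: ZieveMueller2008, §2.1 Lemma (Lüroth)] -/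
theorem adjoin_sq_lt_adjoin (hv : ¬ ∃ c, v = RatFunc.C c) :
    IntermediateField.adjoin K ({v ^ 2} : Set (RatFunc K)) < IntermediateField.adjoin K ({v} : Set (RatFunc K)) := by
  have h : v ^ 2 = ratFuncSubst v hv (RatFunc.X ^ 2) := by rw [map_pow, ratFuncSubst_X]
  rw [h, adjoin_ratFuncSubst_lt_adjoin_iff, max_natDegree_X_sq]
  decide

/-- **The lattice of subfields of `K(u) ⊇ K` has NO atoms**: below every `L ≠ K` lies `K ⊊ K(v²) ⊊ K(v) = L`
(`[K(v) : K(v²)] = 2`), so there are infinite descending chains `K(v) ⊋ K(v²) ⊋ K(v⁴) ⊋ ⋯`, while ascending chains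
above `K(w)` are finite (§3). [cite: ZieveMueller2008, §2.1 Lemma (Lüroth)] -/
theorem not_isAtom (L : IntermediateField K (RatFunc K)) : ¬ IsAtom L := by
  rintro ⟨hL, hmin⟩
  have hg := RatFunc.Luroth.generator_ne_C hL
  have hlt := adjoin_sq_lt_adjoin (RatFunc.Luroth.generator L) hg
  rw [← RatFunc.Luroth.eq_adjoin_generator (E := L)] at hlt
  refine adjoin_ne_bot_of_ne_C (w := RatFunc.Luroth.generator L ^ 2) ?_ (hmin _ hlt)
  have h2 : RatFunc.Luroth.generator L ^ 2 = ratFuncSubst _ hg (RatFunc.X ^ 2) := by rw [map_pow, ratFuncSubst_X]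
  rw [h2]
  exact ratFuncSubst_ne_C _ hg X_sq_ne_C

/-- Hence `K` is never covered: `¬ (K ⋖ L)`. [cite: ZieveMueller2008, §2.1 Lemma (Lüroth)] -/
theorem not_bot_covBy (L : IntermediateField K (RatFunc K)) : ¬ (⊥ ⋖ L) := fun h =>
  not_isAtom L (bot_covBy_iff.mp h)

end Coatom

/-! ### §5. Transport along `σ_v`: `K(t) ≅ K(v)` carries the lattice onto the interval `[K, K(v)]` -/

section Transport

variable (φ : RatFunc K →ₐ[K] RatFunc K)

/-- `map φ` reflects `≤` (a field homomorphism is injective). [cite: ZieveMueller2008, §2.1 Lemma (Lüroth)] -/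
theorem map_le_map_iff_of_algHom {M N : IntermediateField K (RatFunc K)} : M.map φ ≤ N.map φ ↔ M ≤ N := by
  have hinj : Function.Injective φ := φ.injective
  rw [← SetLike.coe_subset_coe, coe_map, coe_map, Set.image_subset_image_iff hinj, SetLike.coe_subset_coe]

/-- `map φ` preserves and reflects `<`. [cite: ZieveMueller2008, §2.1 Lemma (Lüroth)] -/
theorem map_lt_map_iff_of_algHom {M N : IntermediateField K (RatFunc K)} : M.map φ < N.map φ ↔ M < N := by
  simp only [lt_iff_le_not_ge, map_le_map_iff_of_algHom]

/-- A field inside the range of `φ` is the image of its preimage. [cite: ZieveMueller2008, §2.1 Lemma (Lüroth)] -/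
theorem map_comap_eq_of_le_map_top {P : IntermediateField K (RatFunc K)}
    (hP : P ≤ (⊤ : IntermediateField K (RatFunc K)).map φ) : (P.comap φ).map φ = P := by
  refine le_antisymm ((gc_map_comap φ).l_u_le P) fun x hx => ?_
  have hx' : x ∈ (((⊤ : IntermediateField K (RatFunc K)).map φ : IntermediateField K (RatFunc K)) : Set (RatFunc K)) :=
    hP hx
  rw [coe_map, Set.mem_image] at hx'
  obtain ⟨y, -, rfl⟩ := hx'
  exact ⟨y, show φ y ∈ P from hx, rfl⟩

/-- **`map φ` preserves and reflects the covering relation `⋖`** (its range is the lower interval `[K, φ(K(u))]`,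
inside which every field is an image). [cite: ZieveMueller2008, §2.1 Lemma (Lüroth), Corollary (chains)] -/
theorem map_covBy_map_iff_of_algHom {M N : IntermediateField K (RatFunc K)} : M.map φ ⋖ N.map φ ↔ M ⋖ N := by
  constructor
  · rintro ⟨hlt, h⟩
    exact ⟨(map_lt_map_iff_of_algHom φ).mp hlt, fun P hMP hPN =>
      h ((map_lt_map_iff_of_algHom φ).mpr hMP) ((map_lt_map_iff_of_algHom φ).mpr hPN)⟩
  · rintro ⟨hlt, h⟩
    refine ⟨(map_lt_map_iff_of_algHom φ).mpr hlt, fun P hMP hPN => ?_⟩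
    have hP : P ≤ (⊤ : IntermediateField K (RatFunc K)).map φ := hPN.le.trans (map_mono φ le_top)
    rw [← map_comap_eq_of_le_map_top φ hP] at hMP hPN
    exact h ((map_lt_map_iff_of_algHom φ).mp hMP) ((map_lt_map_iff_of_algHom φ).mp hPN)

variable (v : RatFunc K) (hv : ¬ ∃ c, v = RatFunc.C c)

/-- `σ_v(K(u)) = K(v)` as `map`. [cite: ZieveMueller2008, §2.1 Lemma (Lüroth)] -/
theorem map_top_ratFuncSubst :
    (⊤ : IntermediateField K (RatFunc K)).map (ratFuncSubst v hv) = IntermediateField.adjoin K ({v} : Set (RatFunc K)) := by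
  rw [← AlgHom.fieldRange_eq_map, fieldRange_ratFuncSubst]

/-- **`K(f) ≤ K(g) ⟺ K(f ∘ v) ≤ K(g ∘ v)`**. [cite: ZieveMueller2008, §2.1 Lemma (Lüroth)] -/
theorem adjoin_ratFuncSubst_le_adjoin_ratFuncSubst_iff (f g : RatFunc K) :
    IntermediateField.adjoin K ({ratFuncSubst v hv f} : Set (RatFunc K)) ≤
        IntermediateField.adjoin K ({ratFuncSubst v hv g} : Set (RatFunc K)) ↔
      IntermediateField.adjoin K ({f} : Set (RatFunc K)) ≤ IntermediateField.adjoin K ({g} : Set (RatFunc K)) := by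
  rw [← map_adjoin_ratFuncSubst v hv f, ← map_adjoin_ratFuncSubst v hv g, map_le_map_iff_of_algHom]

/-- **`K(f) ⋖ K(g) ⟺ K(f ∘ v) ⋖ K(g ∘ v)`** (chains of fields are transported intact by a right composition).
[cite: ZieveMueller2008, §2.1 Corollary (chains)] -/
theorem adjoin_ratFuncSubst_covBy_adjoin_ratFuncSubst_iff (f g : RatFunc K) :
    IntermediateField.adjoin K ({ratFuncSubst v hv f} : Set (RatFunc K)) ⋖
        IntermediateField.adjoin K ({ratFuncSubst v hv g} : Set (RatFunc K)) ↔
      IntermediateField.adjoin K ({f} : Set (RatFunc K)) ⋖ IntermediateField.adjoin K ({g} : Set (RatFunc K)) := by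
  rw [← map_adjoin_ratFuncSubst v hv f, ← map_adjoin_ratFuncSubst v hv g, map_covBy_map_iff_of_algHom]

/-- **One indecomposable step: `K(f ∘ v) ⋖ K(v)` iff `K(f)` is a coatom iff `f` is indecomposable** (in a complete
decomposition the consecutive fields `E_{i−1} = K(g_i ∘ ⋯)` `⊊ E_i` are adjacent exactly when `g_i` is indecomposable).
[cite: ZieveMueller2008, §2.1 Corollary (chains)][cite: GutierrezSevilla2008, Def. 1 (complete decomposition)] -/
theorem covBy_adjoin_ratFuncSubst_iff (f : RatFunc K) :
    IntermediateField.adjoin K ({ratFuncSubst v hv f} : Set (RatFunc K)) ⋖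
        IntermediateField.adjoin K ({v} : Set (RatFunc K)) ↔
      IsCoatom (IntermediateField.adjoin K ({f} : Set (RatFunc K))) := by
  rw [← covBy_top_iff, ← map_adjoin_ratFuncSubst v hv f, ← map_top_ratFuncSubst v hv, map_covBy_map_iff_of_algHom]

end Transport

/-! ### §6. Complete decompositions: indecomposable right and left components, saturated chains, length bound -/

/-- **Every `w` of degree `≥ 2` has an INDECOMPOSABLE RIGHT component**: `w = f ∘ v` with `K(v)` a coatom (a maximal
element of the finite set of proper fields above `K(w)`). [cite: GutierrezSevilla2008, Def. 1 (complete decomposition)][cite: ZieveMueller2008, §2.1 Corollary (chains)] -/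
theorem exists_rightFactor_isCoatom {w : RatFunc K} (hw : ¬ ∃ c, w = RatFunc.C c)
    (h2 : 2 ≤ max w.num.natDegree w.denom.natDegree) :
    ∃ (v : RatFunc K) (hv : ¬ ∃ c, v = RatFunc.C c) (f : RatFunc K),
      w = ratFuncSubst v hv f ∧ IsCoatom (IntermediateField.adjoin K ({v} : Set (RatFunc K))) := by
  have hFtop : IntermediateField.adjoin K ({w} : Set (RatFunc K)) ≠ ⊤ := fun h => by
    have h1 := (adjoin_eq_top_iff_max_natDegree_eq_one w).mp h
    omega
  have hS : {L : IntermediateField K (RatFunc K) |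
      IntermediateField.adjoin K ({w} : Set (RatFunc K)) ≤ L ∧ L ≠ ⊤}.Finite :=
    (finite_setOf_adjoin_le hw).subset fun L hL => hL.1
  obtain ⟨M, hFM, hMmax⟩ := hS.exists_le_maximal ⟨le_rfl, hFtop⟩
  have hM : IsCoatom M :=
    ⟨hMmax.prop.2, fun N hN => by_contra fun hNtop => hMmax.not_prop_of_gt hN ⟨hFM.trans hN.le, hNtop⟩⟩
  obtain ⟨v, hv, f, hwf, rfl⟩ := (adjoin_le_iff_exists_rightFactor hw M).mp hFM
  exact ⟨v, hv, f, hwf, hM⟩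

/-- **Every `w` of degree `≥ 2` has an INDECOMPOSABLE LEFT component**: `w = f ∘ v` with `K(w) ⋖ K(v)`, i.e. `K(f)` a
coatom (a minimal element of the finite set of fields strictly above `K(w)`). [cite: GutierrezSevilla2008, Def. 1 (complete decomposition)][cite: ZieveMueller2008, §2.1 Corollary (chains)] -/
theorem exists_leftFactor_covBy {w : RatFunc K} (hw : ¬ ∃ c, w = RatFunc.C c)
    (h2 : 2 ≤ max w.num.natDegree w.denom.natDegree) :
    ∃ (v : RatFunc K) (hv : ¬ ∃ c, v = RatFunc.C c) (f : RatFunc K),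
      w = ratFuncSubst v hv f ∧
        IntermediateField.adjoin K ({w} : Set (RatFunc K)) ⋖ IntermediateField.adjoin K ({v} : Set (RatFunc K)) ∧
          IsCoatom (IntermediateField.adjoin K ({f} : Set (RatFunc K))) := by
  have hFtop : IntermediateField.adjoin K ({w} : Set (RatFunc K)) ≠ ⊤ := fun h => by
    have h1 := (adjoin_eq_top_iff_max_natDegree_eq_one w).mp h
    omega
  have hS : {L : IntermediateField K (RatFunc K) | IntermediateField.adjoin K ({w} : Set (RatFunc K)) < L}.Finite :=
    (finite_setOf_adjoin_le hw).subset fun L hL =>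
      show IntermediateField.adjoin K ({w} : Set (RatFunc K)) ≤ L from le_of_lt hL
  obtain ⟨M, hMmin⟩ := hS.exists_minimal ⟨⊤, lt_top_iff_ne_top.mpr hFtop⟩
  have hcov : IntermediateField.adjoin K ({w} : Set (RatFunc K)) ⋖ M :=
    ⟨hMmin.prop, fun L hFL hLM => hMmin.not_prop_of_lt hLM hFL⟩
  obtain ⟨v, hv, f, hwf, rfl⟩ := (adjoin_le_iff_exists_rightFactor hw M).mp hcov.le
  refine ⟨v, hv, f, hwf, hcov, ?_⟩
  rw [← covBy_adjoin_ratFuncSubst_iff v hv f, ← hwf]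
  exact hcov

/-- **Complete decompositions exist: there is a saturated chain `K(w) = E₀ ⋖ E₁ ⋖ ⋯ ⋖ E_n = K(u)`** for every
non-constant `w` (`n = 0` iff `w` is a unit; induction on `deg w`: peel an indecomposable right component `v`,
`w = f ∘ v` with `deg f < deg w`, and transport a saturated chain for `f` along `σ_v` below the last step
`K(v) ⋖ K(u)`).  By §5 the steps are complete decompositions `w = g₁ ∘ ⋯ ∘ g_n`, `g_i` indecomposable.
[cite: GutierrezSevilla2008, Def. 1 (complete decomposition)][cite: ZieveMueller2008, §2.1 Corollary (chains)] -/
theorem exists_saturatedChain {w : RatFunc K} (hw : ¬ ∃ c, w = RatFunc.C c) :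
    ∃ (n : ℕ) (E : Fin (n + 1) → IntermediateField K (RatFunc K)),
      E 0 = IntermediateField.adjoin K ({w} : Set (RatFunc K)) ∧ E (Fin.last n) = ⊤ ∧
        ∀ i : Fin n, E i.castSucc ⋖ E i.succ := by
  -- strong induction on the degree
  suffices H : ∀ (d : ℕ) (w : RatFunc K), ¬ (∃ c, w = RatFunc.C c) → max w.num.natDegree w.denom.natDegree ≤ d →
      ∃ (n : ℕ) (E : Fin (n + 1) → IntermediateField K (RatFunc K)),
        E 0 = IntermediateField.adjoin K ({w} : Set (RatFunc K)) ∧ E (Fin.last n) = ⊤ ∧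
          ∀ i : Fin n, E i.castSucc ⋖ E i.succ from H _ w hw le_rfl
  intro d
  induction d with
  | zero =>
    intro w hw hd
    exact absurd (Nat.le_zero.mp hd) (max_natDegree_ne_zero_of_ne_C hw)
  | succ d ih =>
    intro w hw hd
    by_cases h1 : max w.num.natDegree w.denom.natDegree = 1
    · -- `w` is a unit: the chain `K(w) = K(u)` of length `0`
      refine ⟨0, fun _ => ⊤, ?_, rfl, fun i => i.elim0⟩
      exact ((adjoin_eq_top_iff_max_natDegree_eq_one w).mpr h1).symm
    · have h2 : 2 ≤ max w.num.natDegree w.denom.natDegree := by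
        have h0 := max_natDegree_ne_zero_of_ne_C hw
        omega
      obtain ⟨v, hv, f, hwf, hcoat⟩ := exists_rightFactor_isCoatom hw h2
      have hf : ¬ ∃ c, f = RatFunc.C c := fun hfc =>
        hw (hwf ▸ (ratFuncSubst_eq_C_iff v hv f).mpr hfc)
      -- `deg f < deg w` since `deg v ≥ 2`
      have hdegv : 2 ≤ max v.num.natDegree v.denom.natDegree := ((isCoatom_adjoin_iff v hv).mp hcoat).1
      have hdegf : max f.num.natDegree f.denom.natDegree ≤ d := by
        have hmul := max_natDegree_ratFuncSubst v hv f
        rw [← hwf] at hmul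
        have hf0 := max_natDegree_ne_zero_of_ne_C hf
        by_contra hlt
        have : (d + 1) * 2 ≤ max f.num.natDegree f.denom.natDegree * max v.num.natDegree v.denom.natDegree :=
          Nat.mul_le_mul (by omega) hdegv
        omega
      obtain ⟨n, E, hE0, hEn, hEcov⟩ := ih f hf hdegf
      -- transport along `σ_v` and append the last step `K(v) ⋖ K(u)`
      refine ⟨n + 1, Fin.snoc (fun i => (E i).map (ratFuncSubst v hv)) ⊤, ?_, ?_, ?_⟩
      · have h0 : (0 : Fin (n + 2)) = (0 : Fin (n + 1)).castSucc := rfl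
        rw [h0, Fin.snoc_castSucc, hE0, map_adjoin_ratFuncSubst, hwf]
      · exact Fin.snoc_last _ _
      · intro i
        rcases Fin.eq_castSucc_or_eq_last i with ⟨j, rfl⟩ | rfl
        · rw [← Fin.castSucc_succ, Fin.snoc_castSucc, Fin.snoc_castSucc]
          exact (map_covBy_map_iff_of_algHom _).mpr (hEcov j)
        · rw [Fin.succ_last, Fin.snoc_last, Fin.snoc_castSucc, hEn, map_top_ratFuncSubst, covBy_top_iff]
          exact hcoat

/-- **Length bound: a strict chain `K(w) = E₀ < E₁ < ⋯ < E_n = K(u)` has `2ⁿ ≤ deg w`** (degrees multiply along the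
chain, `[K(u) : K(w)] = ∏ [E_i : E_{i−1}]`, and each `[E_i : E_{i−1}] ≥ 2`; so complete decompositions of `w` have at
most `log₂ deg w` components, though — for rational functions — not always the same number).
[cite: ZieveMueller2008, §2.1 Corollary (chains: [E_i : E_{i−1}] = deg a_i)][cite: Ritt1922, §I p. 53] -/
theorem two_pow_le_max_natDegree_of_chain {w : RatFunc K} (hw : ¬ ∃ c, w = RatFunc.C c) {n : ℕ}
    (E : Fin (n + 1) → IntermediateField K (RatFunc K))
    (hE0 : E 0 = IntermediateField.adjoin K ({w} : Set (RatFunc K)))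
    (hlt : ∀ i : Fin n, E i.castSucc < E i.succ) :
    2 ^ n ≤ max w.num.natDegree w.denom.natDegree := by
  -- `2^k · [K(u) : E_k] ≤ [K(u) : E_0]` by induction on `k`
  have hbot : ∀ i : Fin (n + 1), E i ≠ ⊥ := by
    intro i hi
    have hle : E 0 ≤ E i := by
      refine Fin.induction (motive := fun i => E 0 ≤ E i) le_rfl (fun j hj => hj.trans (hlt j).le) i
    rw [hi, le_bot_iff, hE0] at hle
    exact adjoin_ne_bot_of_ne_C hw hle
  have hfin : ∀ i : Fin (n + 1), 0 < Module.finrank (E i) (RatFunc K) := by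
    intro i
    have hi := hbot i
    rw [RatFunc.Luroth.eq_adjoin_generator (E := E i), RatFunc.finrank_eq_max_natDegree]
    exact Nat.pos_of_ne_zero (max_natDegree_ne_zero_of_ne_C (RatFunc.Luroth.generator_ne_C hi))
  have key : ∀ k : Fin (n + 1),
      2 ^ (k : ℕ) * Module.finrank (E k) (RatFunc K) ≤ Module.finrank (E 0) (RatFunc K) := by
    intro k
    refine Fin.induction (motive := fun k : Fin (n + 1) =>
      2 ^ (k : ℕ) * Module.finrank (E k) (RatFunc K) ≤ Module.finrank (E 0) (RatFunc K)) ?_ ?_ k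
    · simp
    · intro j hj
      have hrel := relfinrank_mul_finrank_top (hlt j).le
      have h2 : 2 ≤ relfinrank (E j.castSucc) (E j.succ) := by
        have hne1 : relfinrank (E j.castSucc) (E j.succ) ≠ 1 := fun h =>
          (hlt j).not_ge (relfinrank_eq_one_iff.mp h)
        have hne0 : relfinrank (E j.castSucc) (E j.succ) ≠ 0 := fun h => by
          rw [h, zero_mul] at hrel
          exact (hfin j.castSucc).ne' hrel.symm
        omega
      calc 2 ^ ((j.succ : Fin (n + 1)) : ℕ) * Module.finrank (E j.succ) (RatFunc K)
          = 2 ^ (j : ℕ) * (2 * Module.finrank (E j.succ) (RatFunc K)) := by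
            rw [Fin.val_succ, pow_succ, mul_assoc]
        _ ≤ 2 ^ (j : ℕ) * (relfinrank (E j.castSucc) (E j.succ) * Module.finrank (E j.succ) (RatFunc K)) :=
            Nat.mul_le_mul_left _ (Nat.mul_le_mul_right _ h2)
        _ = 2 ^ ((j.castSucc : Fin (n + 1)) : ℕ) * Module.finrank (E j.castSucc) (RatFunc K) := by
            rw [hrel, Fin.val_castSucc]
        _ ≤ Module.finrank (E 0) (RatFunc K) := hj
  have h := key (Fin.last n)
  rw [Fin.val_last, hE0, RatFunc.finrank_eq_max_natDegree] at h
  have hpos := hfin (Fin.last n)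
  calc 2 ^ n ≤ 2 ^ n * Module.finrank (E (Fin.last n)) (RatFunc K) := Nat.le_mul_of_pos_right _ hpos
    _ ≤ _ := h

end Literature.FieldTheory.FunctionField
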